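import Literature.MathematicalPhysics.QuantumFieldTheory.Balaban1983to89.B9SectBGWordDeltaAY
import Literature.MathematicalPhysics.QuantumFieldTheory.Balaban1983to89.B9SectBGFrameV4
import Literature.MathematicalPhysics.QuantumFieldTheory.Balaban1983to89.B9SectBKerFrameCodedY

/-!
# Balaban [B9], (3.35)–(3.37) p. 396, (3.72)–(3.75) p. 405 — THE STRUCTURAL AND CLASS FIELDS OF THE ROW-13 G FRAME AT NODE 00's LETTERS:
# commuting shifts and the three further stencils (§1), the DISPLAYED laws `Reg335PlaqY` ((3.35) read on plaquettes), `CplxLettersGY` (the seven further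
# (3.37) letter bounds of r06's G clause) and `VarParBY` (the (3.80)–(3.81) bond-transporter variation) (§2)
# (pub-ymgap N06 G-side plan, Route L, L-5b: fields `L_one_le ∕ T_comm ∕ stencilFB ∕ stencilSt ∕ stencilLoc ∕ reg335 ∕ cplxG` of `B9SectBGFrameV4.GFrame₄`)

T. Bałaban, *Propagators for lattice gauge theories in a background field*, Commun. Math. Phys. **99** (1985) 389–434
[`Balaban1985BackgroundPropagators`, "B9"]; [4] = T. Bałaban, *Propagators and renormalization transformations for lattice gauge
theories. II*, Commun. Math. Phys. **96** (1984) 223–250 [`Balaban1984PropagatorsII`].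

statement-level skeleton of published theorems with citation tags; proofs where landed; nothing here is a claim about the
Yang–Mills mass gap

THE PRINTED LOCI.  (3.35) p. 396 (*«|U(∂p) − 1| < α₀(L^jη)^{−2}η² for p ⊂ B^j(y)»* read through (3.69) p. 404); (3.37) p. 396 (the class `U′ = e^{iηA′}`,
`|A′| < α₁(L^jη)^{−1}`, `|∇_U A′| < α₁(L^jη)^{−2}`); (3.72)–(3.75) p. 405 (the stencils `st(b)` and the dependence sets of the bracket); (3.80)–(3.81)
pp. 406–407 (`Q(U′U) − Q(U) = F₂(A)`, `|F₂(A)| ≦ O(1)α₁`); [4] (2.46) p. 231 (the multiscale distance).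

WHY THIS FILE (seat dag-n06-c gen 13).  r06's G frame `GFrame₄` (V4, gen 13) displays, beyond the root frame's binders, per-member STRUCTURE (`L ≥ 1`, commuting
shifts, three stencils at the root's range `d₀ = 2(d+1)`) and three CLASS readings (`reg335` on plaquettes, `cplxG` = seven (3.37) letter bounds, the
(3.80)–(3.81) sizes).  At NODE 00's letters over the coded carrier (`T := shiftY`, `coord := coordC`, `expA := expAC`, `blk := blkC ι_B`, geometry `geo9Y`):
§1 proves the structure (★ `dist_blkC_tshift_le` — p21's neighbour lemma `distT_blkOf_tshift_le` for every translation of sup-norm `≦ 1` —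
hence `stencilFB_blkC`, `stencilSt_blkC`, `stencilLoc_blkC`, `stencilThrough_blkC`); §2 NAMES the three class readings as `Prop`-valued definitions with
parameters, in the frame's exact shape — `Reg335PlaqY G x ιB C₀ U`, `CplxLettersGY G x ιB β U a`, `VarParBY x parB cVar β U a` — to be DISPLAYED as hypotheses of the
instance (`hreg335P`, `hC37G`, `hvarB`: the coded class implies them) and discharged at the record separately (matrix algebra: g7's
`B9Eq335PlaquetteAtLettersY.norm_holY_sub_one_le_of_reg335` with gen 13's `B9SectBGWordCurlHolY.holY_eq_plaqU` for the first; the (3.37) → letters dictionary of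
`B9SectBCodedClassY` extended for the second and third) — exactly gen 7∕12's treatment of `CplxLettersY` ∕ `VarParY` ∕ `hunitX`.

HONEST SCOPE.  Lattice bookkeeping + three named hypotheses (definitions with parameters, no `… : Prop` fact asserted); nothing of [B9] asserted; count-neutral;
N06 NOT discharged; nothing continuum ∕ OS ∕ mass-gap ∕ Clay.  No `sorry`, no `axiom`, no `instance`, no `notation`.  `--supports stmt-QuantumFields-27364`.

RELATED IN THE TREE, NOT DUPLICATED: `B9SectBGpLettersY.stencilF_blkC ∕ stencilB_blkC ∕ stencil0_geo9K` (g7: the root's one-step stencils — same lemma, one step),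
`B9SectBGpFrameCodedY.CplxLettersY` (g7: the root's (3.37) letters), `B9SectBKerFrameCodedY.VarParY` (gen 12: the site-transporter law), `B9SectBGFrameV4` (the
consumer), `B9Ineq344CutoffDatumTorus.distT_blkOf_tshift_le` (p21 — USED); `T_comm` ∕ `L_one_le` are the landed `B9Thm31SiteCurvatureCommutatorsY.shiftY_shiftY_comm` ∕
`B9GeoLemma21KLevelV1.geo9K_one_le_L` (not restated).
-/

noncomputable section

namespace Literature.MathematicalPhysics.QuantumFieldTheory.Balaban1983to89.B9SectBGClassLettersY

open Literature.MathematicalPhysics.QuantumFieldTheory.Balaban1983to89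
open Literature.MathematicalPhysics.QuantumFieldTheory.Balaban1983to89.Node00 (SiteY BlkY FBondY IBondY CfgY SiteParY BondParY UboxY shiftY qT qK)
open Literature.MathematicalPhysics.QuantumFieldTheory.Balaban1983to89.B6Ineq2142KLevelV1 (β)
open Literature.MathematicalPhysics.QuantumFieldTheory.Balaban1983to89.B6KLevelCensusIndexV1 (KIdx kGeo)
open Literature.MathematicalPhysics.QuantumFieldTheory.Balaban1983to89.B9GeoNormsKLevelV1 (geo9K)
open Literature.MathematicalPhysics.QuantumFieldTheory.Balaban1983to89.B9Eq39Adjoint (R covD covDstar plaqU)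
open Literature.MathematicalPhysics.QuantumFieldTheory.Balaban1983to89.B9Eq352DivForm (tauF)
open Literature.MathematicalPhysics.QuantumFieldTheory.Balaban1983to89.B9Eq369Small (Through)
open Literature.MathematicalPhysics.QuantumFieldTheory.Balaban1983to89.B9Eq372Locality (stBonds mem_stBonds_iff)
open Literature.MathematicalPhysics.QuantumFieldTheory.Balaban1983to89.B9Eq375Locality (locBondsA locBondsA' locBondsA'_eq)
open Literature.MathematicalPhysics.QuantumFieldTheory.Balaban1983to89.B9PinMembersKLevelV1 (MemberY geo9Y bg9Y)
open Literature.MathematicalPhysics.QuantumFieldTheory.Balaban1983to89.B9Eq360DeltaPrimeAY (AfldY)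
open Literature.MathematicalPhysics.QuantumFieldTheory.Balaban1983to89.B9SectBGpLettersY (GVal decY coordC expAC blkC dist_blkC abs_unitVec_le)
open Literature.MathematicalPhysics.QuantumFieldTheory.Balaban1983to89.B9SectBCodedCarrier (CCfg)

variable {d ℓ : ℕ} {hd : 1 ≤ d + 1} {hL : Odd (ℓ + 1) ∧ 1 < ℓ + 1} {b₀ b₁ : ℝ}
variable {𝔸 : Type} [NormedRing 𝔸] [NormedAlgebra ℂ 𝔸] [CompleteSpace 𝔸]

/-! ## §1 Structure: commuting shifts, the stencils at range `2(d+1)` -/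

section Structure

variable (i : KIdx d ℓ hd hL b₀ b₁) (ιB : BlkY i → IBondY i)

omit [NormedRing 𝔸] [NormedAlgebra ℂ 𝔸] [CompleteSpace 𝔸] in
/-- ★ **A TRANSLATION OF SUP-NORM `≦ 1` MOVES THE BLOCK BY AT MOST `2(d+1)`** (p21's neighbour lemma at NODE 00's labelled blocks).
[cite: Balaban1984PropagatorsII, (2.46) p.231, (2.2) p.224] -/
theorem dist_blkC_tshift_le (hι : ∀ s : BlkY i, β i.hN i.D i.hk (ιB s) = s) (v : Fin (d + 1) → ℤ) (hv : ∀ μ, |v μ| ≤ 1) (z : SiteY i) :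
    (geo9K i).dist (blkC i ιB z) (blkC i ιB (B6MultiLevelTorusOperator.tshift _ v z)) ≤ 2 * ((d : ℝ) + 1) := by
  have hMh : 3 ≤ i.Mh := le_trans (by norm_num) i.hM8
  have hR : 2 * (ℓ + 1) ≤ i.R := le_trans (Nat.mul_le_mul_left 2 (Nat.le_self_pow (by norm_num) (ℓ + 1))) i.hR2
  have hP4 : ∀ μ, 4 ≤ i.P' μ := fun μ => le_trans (by norm_num) (i.hP5 μ)
  rw [dist_blkC i ιB hι, SimpleGraph.dist_comm]
  exact_mod_cast B9Ineq344CutoffDatumTorus.distT_blkOf_tshift_le i.D hMh hR hP4 v hv z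

omit [NormedRing 𝔸] [NormedAlgebra ℂ 𝔸] [CompleteSpace 𝔸] in
/-- `x + e_μ − e_ν` is the translation of `x` by `e_μ − e_ν` (sup-norm `≦ 1`). [cite: Balaban1984PropagatorsII, (2.2) p.224, bookkeeping] -/
theorem shiftY_symm_shiftY_eq_tshift (μ ν : Fin (d + 1)) (z : SiteY i) :
    (shiftY i ν).symm (shiftY i μ z) =
      B6MultiLevelTorusOperator.tshift _ (B6MultiLevelTorusOperator.unitVec μ - B6MultiLevelTorusOperator.unitVec ν) z := by
  simp only [shiftY, B6MultiLevelTorusOperator.tshift_symm_apply, B6MultiLevelTorusOperator.tshift_tshift, sub_eq_add_neg]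

omit [NormedRing 𝔸] [NormedAlgebra ℂ 𝔸] [CompleteSpace 𝔸] in
/-- `|e_μ − e_ν|_∞ ≦ 1`. [folklore] [cite: Balaban1984PropagatorsII, (2.2) p.224, bookkeeping] -/
theorem abs_unitVec_sub_unitVec_le (μ ν κ : Fin (d + 1)) :
    |(B6MultiLevelTorusOperator.unitVec μ - B6MultiLevelTorusOperator.unitVec ν) κ| ≤ 1 := by
  have h0 : ∀ ρ : Fin (d + 1), 0 ≤ B6MultiLevelTorusOperator.unitVec ρ κ ∧ B6MultiLevelTorusOperator.unitVec ρ κ ≤ 1 := fun ρ => by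
    unfold B6MultiLevelTorusOperator.unitVec
    rw [Pi.single_apply]
    split_ifs <;> simp
  rw [Pi.sub_apply, abs_sub_le_iff]
  constructor <;> linarith [h0 μ, h0 ν]

omit [NormedRing 𝔸] [NormedAlgebra ℂ 𝔸] [CompleteSpace 𝔸] in
/-- shifts commute with inverse shifts: `(x − e_ν) + e_μ = (x + e_μ) − e_ν`. [cite: Balaban1984PropagatorsII, (2.2) p.224, bookkeeping] -/
theorem shiftY_shiftY_symm_comm (μ ν : Fin (d + 1)) (z : SiteY i) : shiftY i μ ((shiftY i ν).symm z) = (shiftY i ν).symm (shiftY i μ z) := by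
  simp only [shiftY, B6MultiLevelTorusOperator.tshift_symm_apply, B6MultiLevelTorusOperator.tshift_tshift, add_comm]

omit [NormedRing 𝔸] [NormedAlgebra ℂ 𝔸] [CompleteSpace 𝔸] in
/-- ★ FIELD `stencilFB`: the block of `x + e_μ − e_ν` is within `2(d+1)` of the block of `x`. [cite: Balaban1984PropagatorsII, (2.46) p.231; Balaban1985BackgroundPropagators, (3.75) p.405] -/
theorem stencilFB_blkC (hι : ∀ s : BlkY i, β i.hN i.D i.hk (ιB s) = s) (μ ν : Fin (d + 1)) (z : SiteY i) :
    (geo9K i).dist (blkC i ιB z) (blkC i ιB ((shiftY i ν).symm (shiftY i μ z))) ≤ 2 * ((d : ℝ) + 1) := by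
  rw [shiftY_symm_shiftY_eq_tshift]
  exact dist_blkC_tshift_le i ιB hι _ (abs_unitVec_sub_unitVec_le μ ν) z

omit [NormedRing 𝔸] [NormedAlgebra ℂ 𝔸] [CompleteSpace 𝔸] in
/-- the block of `x + e_μ` is within `2(d+1)` of the block of `x`. [cite: Balaban1984PropagatorsII, (2.46) p.231] -/
theorem stencilF_blkC' (hι : ∀ s : BlkY i, β i.hN i.D i.hk (ιB s) = s) (μ : Fin (d + 1)) (z : SiteY i) :
    (geo9K i).dist (blkC i ιB z) (blkC i ιB (shiftY i μ z)) ≤ 2 * ((d : ℝ) + 1) :=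
  B9SectBGpLettersY.stencilF_blkC i ιB hι μ z

omit [NormedRing 𝔸] [NormedAlgebra ℂ 𝔸] [CompleteSpace 𝔸] in
/-- the block of `x − e_μ` is within `2(d+1)` of the block of `x`. [cite: Balaban1984PropagatorsII, (2.46) p.231] -/
theorem stencilB_blkC' (hι : ∀ s : BlkY i, β i.hN i.D i.hk (ιB s) = s) (μ : Fin (d + 1)) (z : SiteY i) :
    (geo9K i).dist (blkC i ιB z) (blkC i ιB ((shiftY i μ).symm z)) ≤ 2 * ((d : ℝ) + 1) :=
  B9SectBGpLettersY.stencilB_blkC i ιB hι μ z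

omit [NormedRing 𝔸] [NormedAlgebra ℂ 𝔸] [CompleteSpace 𝔸] in
/-- the block of `x` is within `2(d+1)` of itself. [cite: Balaban1984PropagatorsII, (2.46) p.231] -/
theorem stencil0_blkC (z : SiteY i) : (geo9K i).dist (blkC i ιB z) (blkC i ιB z) ≤ 2 * ((d : ℝ) + 1) :=
  B9SectBGpLettersY.stencil0_geo9K i _

omit [NormedRing 𝔸] [NormedAlgebra ℂ 𝔸] [CompleteSpace 𝔸] in
/-- ★ FIELD `stencilSt`: every bond of `st(b)`, `b = ⟨x, x+e_μ⟩`, starts within `2(d+1)` of the block of `x` (its sites are `x`, `x ± e_ν`, `x + e_μ`,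
`x + e_μ − e_ν`). [cite: Balaban1985BackgroundPropagators, (3.72) p.405 (st(b)); Balaban1984PropagatorsII, (2.46) p.231] -/
theorem stencilSt_blkC (hι : ∀ s : BlkY i, β i.hN i.D i.hk (ιB s) = s) (μ : Fin (d + 1)) (x : SiteY i) (q : Fin (d + 1) × SiteY i)
    (hq : q ∈ stBonds (shiftY i) μ x) : (geo9K i).dist (blkC i ιB x) (blkC i ιB q.2) ≤ 2 * ((d : ℝ) + 1) := by
  simp only [stBonds, B9Eq372Locality.dirBonds, B9Eq372Locality.pBonds, Set.mem_iUnion, Set.mem_union, Set.mem_insert_iff,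
    Set.mem_singleton_iff, Set.mem_setOf_eq, exists_prop] at hq
  obtain ⟨ν, -, ((rfl | rfl | rfl | rfl) | (rfl | rfl | rfl | rfl))⟩ := hq
  · exact stencil0_blkC i ιB x
  · exact stencilF_blkC' i ιB hι ν x
  · exact stencilF_blkC' i ιB hι μ x
  · exact stencil0_blkC i ιB x
  · exact stencilB_blkC' i ιB hι ν x
  · rw [Equiv.apply_symm_apply]; exact stencil0_blkC i ιB x
  · rw [shiftY_shiftY_symm_comm]; exact stencilFB_blkC i ιB hι μ ν x
  · exact stencilB_blkC' i ιB hι ν x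

omit [NormedRing 𝔸] [NormedAlgebra ℂ 𝔸] [CompleteSpace 𝔸] in
/-- ★ FIELD `stencilLoc`: every bond of the dependence set `locBondsA′` of the bracket at `b = ⟨x, x+e_μ⟩` starts within `2(d+1)` of the block of `x`
(sites `x + e_μ`, `x − e_ν`, `x + e_μ − e_ν`). [cite: Balaban1985BackgroundPropagators, (3.75) p.405; Balaban1984PropagatorsII, (2.46) p.231] -/
theorem stencilLoc_blkC (hι : ∀ s : BlkY i, β i.hN i.D i.hk (ιB s) = s) (μ : Fin (d + 1)) (x : SiteY i) (q : Fin (d + 1) × SiteY i)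
    (hq : q ∈ locBondsA' (shiftY i) μ x) : (geo9K i).dist (blkC i ιB x) (blkC i ιB q.2) ≤ 2 * ((d : ℝ) + 1) := by
  simp only [locBondsA', B9Eq375Locality.dirBondsA', Set.mem_iUnion, Set.mem_insert_iff, Set.mem_singleton_iff] at hq
  obtain ⟨ν, rfl | rfl | rfl⟩ := hq
  · exact stencilF_blkC' i ιB hι μ x
  · exact stencilB_blkC' i ιB hι ν x
  · exact stencilFB_blkC i ιB hι μ ν x

omit [NormedRing 𝔸] [NormedAlgebra ℂ 𝔸] [CompleteSpace 𝔸] in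
/-- the base point of a plaquette THROUGH the bond `⟨x, x+e_μ⟩` lies within `2(d+1)` of the block of `x` (it is `x`, `x − e_κ` or `x − e_ν`).
[cite: Balaban1985BackgroundPropagators, p.404 after (3.69); Balaban1984PropagatorsII, (2.46) p.231] -/
theorem stencilThrough_blkC (hι : ∀ s : BlkY i, β i.hN i.D i.hk (ιB s) = s) {μ : Fin (d + 1)} {x : SiteY i} {m n : Fin (d + 1)} {y : SiteY i}
    (h : Through (shiftY i) μ x m n y) : (geo9K i).dist (blkC i ιB x) (blkC i ιB y) ≤ 2 * ((d : ℝ) + 1) := by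
  obtain ⟨-, (⟨-, h | h⟩ | ⟨-, h | h⟩)⟩ := h <;> rw [h]
  · exact stencil0_blkC i ιB x
  · exact stencilB_blkC' i ιB hι m x
  · exact stencil0_blkC i ιB x
  · exact stencilB_blkC' i ιB hι n x

end Structure

/-! ## §2 The three class readings, NAMED (displayed hypotheses of the instance) -/

section Laws

variable {Mstar : ℕ} (G : Subgroup 𝔸ˣ) (x : MemberY d ℓ hd hL b₀ b₁ Mstar) (parB : BondParY 𝔸 x.toKIdx) (ιB : BlkY x.toKIdx → IBondY x.toKIdx)

/-- **THE (3.35) PLAQUETTE READING AT THE LETTERS** (FIELD `reg335`): every plaquette through a bond `⟨x, x+e_μ⟩` satisfies `‖U(∂p) − 1‖ ≦ C₀·L^{−2j(x)}`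
at the charted `G`-valued base (`j(x)` = the scale of the labelled block of `x`) — print's (3.35)∕(3.69) with `Mα₀ ≦ a` absorbed in `C₀`.  A named hypothesis;
at the record for the matrix algebra it is `B9Eq335PlaquetteAtLettersY.norm_holY_sub_one_le_of_reg335` + `B9SectBGWordCurlHolY.holY_eq_plaqU` (class cubes
cover the plaquettes through a block). [cite: Balaban1985BackgroundPropagators, (3.35) p.396, (3.69) p.404] -/
def Reg335PlaqY (C₀ : ℝ) (U : CfgY 𝔸 x.toKIdx) : Prop :=
  ∀ (μ : Fin (d + 1)) (z : SiteY x.toKIdx) (m n : Fin (d + 1)) (y : SiteY x.toKIdx), Through (shiftY x.toKIdx) μ z m n y →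
    ‖(plaqU (shiftY x.toKIdx) (coordC G x.toKIdx (.base U)) m n y : 𝔸) - 1‖ ≤ C₀ * (((geo9Y x).L ^ (geo9Y x).scale (blkC x.toKIdx ιB z))⁻¹) ^ 2

/-- **THE SEVEN FURTHER (3.37) LETTER BOUNDS OF r06's G CLAUSE** (FIELD `cplxG`) at a (base `U`, multiplier `a`) pair, exponent `β`: the charted field
`A′ = chartA a` and its covariant differences along the charted base, read at the scale of the block of the BASE POINT of each stencil — `|A′(b′)| ≦ β(Lʲη)⁻¹`
on `st(b)`, on `locBondsA`, at `x + e_μ − e_ν`; `η⁻¹|∇A′| ≦ β(Lʲη)⁻²` (two placements); `|τA′| ≦ β(Lʲη)⁻¹`; the plaquette-through second-order pair.  A named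
hypothesis (the coded class implies it); print's (3.37) gives it with `β = O(1)·α₁` (neighbouring blocks differ by one level).
[cite: Balaban1985BackgroundPropagators, (3.37) p.396, (3.72)–(3.75) p.405] -/
def CplxLettersGY (β : ℝ) (U : CfgY 𝔸 x.toKIdx) (a : AfldY 𝔸 x.toKIdx) : Prop :=
  (∀ (μ ν : Fin (d + 1)) (z : SiteY x.toKIdx),
      ‖(((geo9Y x).eta : ℂ))⁻¹ • covDstar (shiftY x.toKIdx) (coordC G x.toKIdx (.base U)) ν (expAC x.toKIdx (.base U) (.mult a) ν) (shiftY x.toKIdx μ z)‖ ≤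
        β * ((geo9Y x).len (blkC x.toKIdx ιB z) ^ 2)⁻¹) ∧
  (∀ (μ ν k : Fin (d + 1)) (z : SiteY x.toKIdx),
      ‖(((geo9Y x).eta : ℂ))⁻¹ • covD (shiftY x.toKIdx) (coordC G x.toKIdx (.base U)) μ (expAC x.toKIdx (.base U) (.mult a) k) ((shiftY x.toKIdx ν).symm z)‖ ≤
        β * ((geo9Y x).len (blkC x.toKIdx ιB z) ^ 2)⁻¹) ∧
  (∀ (μ k : Fin (d + 1)) (z : SiteY x.toKIdx),
      ‖tauF (shiftY x.toKIdx) (coordC G x.toKIdx (.base U)) μ (expAC x.toKIdx (.base U) (.mult a) k) z‖ ≤ β * ((geo9Y x).len (blkC x.toKIdx ιB z))⁻¹) ∧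
  (∀ (k μ ν : Fin (d + 1)) (z : SiteY x.toKIdx),
      ‖expAC x.toKIdx (.base U) (.mult a) k ((shiftY x.toKIdx ν).symm (shiftY x.toKIdx μ z))‖ ≤ β * ((geo9Y x).len (blkC x.toKIdx ιB z))⁻¹) ∧
  (∀ (μ : Fin (d + 1)) (z : SiteY x.toKIdx) (m : Fin (d + 1)) (w : SiteY x.toKIdx), (m, w) ∈ stBonds (shiftY x.toKIdx) μ z →
      ‖expAC x.toKIdx (.base U) (.mult a) m w‖ ≤ β * ((geo9Y x).len (blkC x.toKIdx ιB z))⁻¹) ∧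
  (∀ (μ : Fin (d + 1)) (z : SiteY x.toKIdx) (m : Fin (d + 1)) (w : SiteY x.toKIdx), (m, w) ∈ locBondsA (shiftY x.toKIdx) μ z →
      ‖expAC x.toKIdx (.base U) (.mult a) m w‖ ≤ β * ((geo9Y x).len (blkC x.toKIdx ιB z))⁻¹) ∧
  (∀ (μ : Fin (d + 1)) (z : SiteY x.toKIdx) (m n : Fin (d + 1)) (y : SiteY x.toKIdx), Through (shiftY x.toKIdx) μ z m n y →
      ‖covD (shiftY x.toKIdx) (coordC G x.toKIdx (.base U)) m (expAC x.toKIdx (.base U) (.mult a) n) y‖ ≤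
          (geo9Y x).eta * (β * (((geo9Y x).len (blkC x.toKIdx ιB z))⁻¹) ^ 2) ∧
        ‖covD (shiftY x.toKIdx) (coordC G x.toKIdx (.base U)) n (expAC x.toKIdx (.base U) (.mult a) m) y‖ ≤
          (geo9Y x).eta * (β * (((geo9Y x).len (blkC x.toKIdx ιB z))⁻¹) ^ 2))

end Laws

section LawB

variable (i : KIdx d ℓ hd hL b₀ b₁) (parB : BondParY 𝔸 i)

/-- **THE (3.80)–(3.81) BOND-TRANSPORTER VARIATION LAW** at a (base `U`, multiplier `a`) pair with constant `c_var` at exponent `β`: along every averaging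
contour of `Q(·)` (the transporters `qT parB · ι f` with `q(ι, f) ≠ 0`) the adjoint action of the transporter of `e^{iηa}U` differs from that of `U` by
`≦ c_var·β` in operator norm, and so does that of the inverted transporters (for `Q*`) — print p. 406: *«Q(U′U) = Q(U) + F₂(A), |F₂(A)| ≦ O(1)α₁»*.  The bond
twin of gen 12's site law `B9SectBKerFrameCodedY.VarParY`; a named hypothesis. [cite: Balaban1985BackgroundPropagators, (3.80)–(3.81) pp.406–407, (3.37) p.396] -/
def VarParBY (cVar β : ℝ) (U : CfgY 𝔸 i) (a : AfldY 𝔸 i) : Prop :=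
  ∀ (ι' : IBondY i) (f : FBondY i), qK i ι' f ≠ 0 → ∀ E : 𝔸,
    ‖R (qT i parB (decY i (.prod U a)) ι' f) E - R (qT i parB U ι' f) E‖ ≤ cVar * β * ‖E‖ ∧
    ‖R (qT i parB (decY i (.prod U a)) ι' f)⁻¹ E - R (qT i parB U ι' f)⁻¹ E‖ ≤ cVar * β * ‖E‖

end LawB

end Literature.MathematicalPhysics.QuantumFieldTheory.Balaban1983to89.B9SectBGClassLettersY

end
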